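import Mathlib

/-!
# `PermanentalConeHard` (stmt-ValiantsHypothesis-8654), line `birth` — facet-contact obstruction I

Route `PermanentalCones` of `ValiantsHypothesis`, crux `PermanentalConeHard`, stub
`stub_linearFactorsOfHyperplaneVanishing`: the commutative-algebra half of the NO-GO theorem for
the "facet-contact" strategy.  If a real polynomial `q` in finitely many variables vanishes on a
nonempty relatively open piece of each of `K` pairwise non-proportional hyperplanes `ker ℓ_k`,
then `q = 0` or `K ≤ totalDegree q`.

Proof.
* `HyperplaneVanishing.linForm_dvd_of_vanishing` (divisibility lemma): if `q` vanishes on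
  `U ∩ ker ℓ` (`U` open, meeting `ker ℓ`, `ℓ ≠ 0`) then the linear form
  `L = ∑ j, C (ℓ j) * X j` divides `q`.  Pick `j₀` with `ℓ j₀ ≠ 0`; the substitution
  `X j₀ ↦ (ℓ j₀)⁻¹ (X j₀ - ∑_{j ≠ j₀} ℓ j X j)` (inverse: `X j₀ ↦ L`) is an algebra automorphism
  carrying `L` to `X j₀`, which reduces to the coordinate hyperplane `{y j₀ = 0}`
  (`HyperplaneVanishing.X_dvd_of_vanishing`): killing the variable `X j₀` in `p` leaves a
  polynomial vanishing on a nonempty open set, hence zero (`MvPolynomial.funext_set` on a box),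
  and `X j₀` divides `p - p|_{X j₀ = 0}`.
* `HyperplaneVanishing.linForm_dvd_mul`: `L` is prime-like (`L ∣ a * b → L ∣ a ∨ L ∣ b`), again by
  the divisibility lemma (if `a` does not vanish on `ker ℓ`, then `b` vanishes on the relatively
  open set `{a ≠ 0} ∩ ker ℓ`).
* `HyperplaneVanishing.peel`: peeling off the `K` pairwise non-associated linear factors one at a
  time, `totalDegree (L * q') = 1 + totalDegree q'` over the domain `ℝ`.

References: folklore (every step is elementary and proved in full here).
-/

set_option linter.dupNamespace false

noncomputable section

namespace Summit.ValiantsHypothesis.ValiantsHypothesis.Theorems.PermanentalConesPermanentalConeHard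

open MvPolynomial Finset
open scoped BigOperators

namespace HyperplaneVanishing

/-! ### Substitutions -/

/-- `MvPolynomial.eval` commutes with substitution `bind₁` (Mathlib's `eval₂Hom_bind₁` for the
identity ring map). [folklore] -/
theorem eval_bind₁ {R : Type*} [CommSemiring R] {σ τ : Type*} (x : τ → R)
    (f : σ → MvPolynomial τ R) (p : MvPolynomial σ R) :
    eval x (bind₁ f p) = eval (fun i => eval x (f i)) p :=
  eval₂Hom_bind₁ _ _ _ _

/-- Killing the variable `X j₀` (substituting `0` for it) changes a polynomial by a multiple of
`X j₀`. [folklore] -/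
theorem X_dvd_sub_bind₁_update_zero {R : Type*} [CommRing R] {σ : Type*} [DecidableEq σ]
    (j₀ : σ) (p : MvPolynomial σ R) :
    (X j₀ : MvPolynomial σ R) ∣ p - bind₁ (Function.update X j₀ 0) p := by
  induction p using MvPolynomial.induction_on with
  | C a =>
    rw [bind₁_C_right, sub_self]
    exact dvd_zero _
  | add p q hp hq =>
    rw [map_add, add_sub_add_comm]
    exact dvd_add hp hq
  | mul_X p i hp =>
    rw [map_mul, bind₁_X_right]
    rcases eq_or_ne i j₀ with rfl | hne
    · rw [Function.update_self, mul_zero, sub_zero]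
      exact dvd_mul_left _ _
    · rw [Function.update_of_ne hne, ← sub_mul]
      exact dvd_mul_of_dvd_left hp _

variable {σ : Type*} [Fintype σ]

/-! ### Polynomials vanishing on open sets -/

/-- A real polynomial in finitely many variables vanishing on a nonempty open set is zero
(an open set contains a box with infinite sides; `MvPolynomial.funext_set`). [folklore] -/
theorem eq_zero_of_eval_eq_zero {W : Set (σ → ℝ)} (hW : IsOpen W) {y₀ : σ → ℝ} (hy₀ : y₀ ∈ W)
    (r : MvPolynomial σ ℝ) (hr : ∀ y ∈ W, eval y r = 0) : r = 0 := by
  obtain ⟨ε, hε, hball⟩ := Metric.isOpen_iff.mp hW y₀ hy₀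
  rw [ball_pi _ hε] at hball
  refine funext_set (fun b => Metric.ball (y₀ b) ε) (fun b => ?_) fun x hx => ?_
  · rw [Real.ball_eq_Ioo]
    exact Set.Ioo_infinite (by linarith)
  · rw [hr x (hball hx), map_zero]

/-! ### The linear form `∑ j, C (ℓ j) * X j` -/

/-- Evaluation of the linear form with coefficient vector `ℓ` is the dot product with `ℓ`.
[folklore] -/
theorem eval_linForm (ℓ x : σ → ℝ) :
    eval x (∑ j, C (ℓ j) * X j : MvPolynomial σ ℝ) = dotProduct ℓ x := by
  simp only [map_sum, map_mul, eval_C, eval_X, dotProduct]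

/-- A linear form with a nonzero coefficient vector is a nonzero polynomial. [folklore] -/
theorem linForm_ne_zero {ℓ : σ → ℝ} (hℓ : ℓ ≠ 0) :
    (∑ j, C (ℓ j) * X j : MvPolynomial σ ℝ) ≠ 0 := by
  classical
  obtain ⟨j₀, hj⟩ := Function.ne_iff.mp hℓ
  intro h
  have h' := congrArg (eval (Pi.single j₀ 1)) h
  rw [eval_linForm, dotProduct_single, mul_one, map_zero] at h'
  exact hj h'

/-- Linear forms are homogeneous of degree `1`. [folklore] -/
theorem isHomogeneous_linForm (ℓ : σ → ℝ) :
    (∑ j, C (ℓ j) * X j : MvPolynomial σ ℝ).IsHomogeneous 1 :=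
  IsHomogeneous.sum _ _ _ fun j _ => (isHomogeneous_X ℝ j).C_mul (ℓ j)

/-- A nonzero linear form has total degree `1`. [folklore] -/
theorem totalDegree_linForm {ℓ : σ → ℝ} (hℓ : ℓ ≠ 0) :
    (∑ j, C (ℓ j) * X j : MvPolynomial σ ℝ).totalDegree = 1 :=
  (isHomogeneous_linForm ℓ).totalDegree (linForm_ne_zero hℓ)

variable [DecidableEq σ]

/-- **Coordinate hyperplane case.** If `p` vanishes at every point `y ∈ V` with `y j₀ = 0`
(`V` open, containing such a point), then `X j₀ ∣ p`: the polynomial `p|_{X j₀ = 0}` vanishes on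
the nonempty open set `{y | y[j₀ ↦ 0] ∈ V}`, hence is zero. [folklore] -/
theorem X_dvd_of_vanishing (j₀ : σ) (p : MvPolynomial σ ℝ) {V : Set (σ → ℝ)} (hV : IsOpen V)
    {y₀ : σ → ℝ} (hy₀ : y₀ ∈ V) (hy₀j : y₀ j₀ = 0)
    (hp : ∀ y ∈ V, y j₀ = 0 → eval y p = 0) : (X j₀ : MvPolynomial σ ℝ) ∣ p := by
  have hr : bind₁ (Function.update X j₀ 0) p = 0 := by
    have hcont : Continuous fun y : σ → ℝ => Function.update y j₀ (0 : ℝ) :=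
      continuous_id.update j₀ continuous_const
    refine eq_zero_of_eval_eq_zero (hV.preimage hcont) (y₀ := y₀) ?_ _ fun y hy => ?_
    · show Function.update y₀ j₀ 0 ∈ V
      rwa [← hy₀j, Function.update_eq_self]
    · have hφ : (fun i => eval y (Function.update (X : σ → MvPolynomial σ ℝ) j₀ 0 i)) =
          Function.update y j₀ 0 := by
        funext i
        rcases eq_or_ne i j₀ with rfl | hne
        · rw [Function.update_self, Function.update_self, map_zero]
        · rw [Function.update_of_ne hne, Function.update_of_ne hne, eval_X]
      rw [eval_bind₁, hφ]
      exact hp _ hy (Function.update_self _ _ _)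
  have h := X_dvd_sub_bind₁_update_zero j₀ p
  rwa [hr, sub_zero] at h

/-- Substitutions fixing every variable but `X j₀` fix the part of the linear form not involving
`X j₀`. [folklore] -/
theorem bind₁_update_sum_erase (ℓ : σ → ℝ) (j₀ : σ) (v : MvPolynomial σ ℝ) :
    bind₁ (Function.update X j₀ v) (∑ j ∈ univ.erase j₀, C (ℓ j) * X j : MvPolynomial σ ℝ) =
      ∑ j ∈ univ.erase j₀, C (ℓ j) * X j := by
  rw [map_sum]
  refine Finset.sum_congr rfl fun j hj => ?_
  rw [map_mul, bind₁_C_right, bind₁_X_right, Function.update_of_ne (Finset.ne_of_mem_erase hj)]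

/-- The straightening substitution `θ : X j₀ ↦ (ℓ j₀)⁻¹ (X j₀ - ∑_{j ≠ j₀} ℓ j X j)` carries the
linear form `∑ j, ℓ j X j` to the coordinate `X j₀`. [folklore] -/
theorem bind₁_fwd_linForm {ℓ : σ → ℝ} {j₀ : σ} (hj : ℓ j₀ ≠ 0) {θ : σ → MvPolynomial σ ℝ}
    (hθ : θ = Function.update X j₀
      (C (ℓ j₀)⁻¹ * (X j₀ - ∑ j ∈ univ.erase j₀, C (ℓ j) * X j))) :
    bind₁ θ (∑ j, C (ℓ j) * X j : MvPolynomial σ ℝ) = X j₀ := by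
  rw [← Finset.add_sum_erase univ (fun j => C (ℓ j) * (X j : MvPolynomial σ ℝ)) (mem_univ j₀),
    map_add, hθ, bind₁_update_sum_erase, map_mul, bind₁_C_right, bind₁_X_right,
    Function.update_self, ← mul_assoc, ← C_mul, mul_inv_cancel₀ hj, C_1, one_mul,
    sub_add_cancel]

/-- The substitution `θ' : X j₀ ↦ ∑ j, ℓ j X j` is a left inverse of the straightening
substitution `θ` of `bind₁_fwd_linForm`. [folklore] -/
theorem bind₁_bwd_fwd {ℓ : σ → ℝ} {j₀ : σ} (hj : ℓ j₀ ≠ 0) {θ θ' : σ → MvPolynomial σ ℝ}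
    (hθ : θ = Function.update X j₀
      (C (ℓ j₀)⁻¹ * (X j₀ - ∑ j ∈ univ.erase j₀, C (ℓ j) * X j)))
    (hθ' : θ' = Function.update X j₀ (∑ j, C (ℓ j) * X j)) (p : MvPolynomial σ ℝ) :
    bind₁ θ' (bind₁ θ p) = p := by
  have hgen : (fun i => bind₁ θ' (θ i)) = (X : σ → MvPolynomial σ ℝ) := by
    funext i
    rcases eq_or_ne i j₀ with rfl | hne
    · rw [hθ, Function.update_self, map_mul, bind₁_C_right, map_sub, bind₁_X_right, hθ',
        bind₁_update_sum_erase, Function.update_self,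
        ← Finset.add_sum_erase univ (fun j => C (ℓ j) * (X j : MvPolynomial σ ℝ)) (mem_univ _),
        add_sub_cancel_right, ← mul_assoc, ← C_mul, inv_mul_cancel₀ hj, C_1, one_mul]
    · rw [hθ, Function.update_of_ne hne, bind₁_X_right, hθ', Function.update_of_ne hne]
  rw [bind₁_bind₁, hgen, bind₁_X_left, AlgHom.id_apply]

/-! ### The divisibility lemma -/

/-- **Divisibility lemma.** If `ℓ ≠ 0`, `U` is open and meets the hyperplane `ker ℓ`, and `q`
vanishes on `U ∩ ker ℓ`, then the linear form `∑ j, ℓ j X j` divides `q`. [folklore] -/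
theorem linForm_dvd_of_vanishing {ℓ : σ → ℝ} (hℓ : ℓ ≠ 0) (q : MvPolynomial σ ℝ)
    {U : Set (σ → ℝ)} (hU : IsOpen U) {x₀ : σ → ℝ} (hx₀ : x₀ ∈ U) (hx₀ℓ : dotProduct ℓ x₀ = 0)
    (hq : ∀ x ∈ U, dotProduct ℓ x = 0 → eval x q = 0) :
    (∑ j, C (ℓ j) * X j : MvPolynomial σ ℝ) ∣ q := by
  obtain ⟨j₀, hj⟩ := Function.ne_iff.mp hℓ
  obtain ⟨θ, hθ⟩ : ∃ θ : σ → MvPolynomial σ ℝ, θ = Function.update X j₀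
      (C (ℓ j₀)⁻¹ * (X j₀ - ∑ j ∈ univ.erase j₀, C (ℓ j) * X j)) := ⟨_, rfl⟩
  obtain ⟨θ', hθ'⟩ : ∃ θ' : σ → MvPolynomial σ ℝ,
      θ' = Function.update X j₀ (∑ j, C (ℓ j) * X j) := ⟨_, rfl⟩
  have hφ : Continuous fun y : σ → ℝ => fun i => eval y (θ i) :=
    continuous_pi fun i => continuous_eval (θ i)
  have hdiv : (X j₀ : MvPolynomial σ ℝ) ∣ bind₁ θ q := by
    refine X_dvd_of_vanishing j₀ (bind₁ θ q) (hU.preimage hφ) (y₀ := fun i => eval x₀ (θ' i))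
      ?_ ?_ fun y hy hyj => ?_
    · have hid : (fun i => eval (fun i' => eval x₀ (θ' i')) (θ i)) = x₀ := by
        funext i
        have h := congrArg (eval x₀) (bind₁_bwd_fwd hj hθ hθ' (X i))
        rwa [eval_bind₁, eval_bind₁, eval_X, eval_X] at h
      show (fun i => eval (fun i' => eval x₀ (θ' i')) (θ i)) ∈ U
      rwa [hid]
    · show eval x₀ (θ' j₀) = 0
      rw [hθ', Function.update_self, eval_linForm, hx₀ℓ]
    · rw [eval_bind₁]
      refine hq _ hy ?_
      have h := congrArg (eval y) (bind₁_fwd_linForm hj hθ)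
      rw [eval_bind₁, eval_linForm, eval_X] at h
      rw [h, hyj]
  have h := map_dvd (bind₁ θ') hdiv
  rwa [bind₁_X_right, bind₁_bwd_fwd hj hθ hθ' q, hθ', Function.update_self] at h

/-- **Linear forms are prime-like**: if `∑ j, ℓ j X j` (`ℓ ≠ 0`) divides `a * b`, it divides `a`
or `b` (if `a` does not vanish identically on `ker ℓ`, then `b` vanishes on the nonempty relatively
open subset `{a ≠ 0} ∩ ker ℓ`). [folklore] -/
theorem linForm_dvd_mul {ℓ : σ → ℝ} (hℓ : ℓ ≠ 0) {a b : MvPolynomial σ ℝ}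
    (h : (∑ j, C (ℓ j) * X j : MvPolynomial σ ℝ) ∣ a * b) :
    (∑ j, C (ℓ j) * X j : MvPolynomial σ ℝ) ∣ a ∨ (∑ j, C (ℓ j) * X j : MvPolynomial σ ℝ) ∣ b := by
  by_cases ha : ∀ x : σ → ℝ, dotProduct ℓ x = 0 → eval x a = 0
  · exact Or.inl (linForm_dvd_of_vanishing hℓ a isOpen_univ (Set.mem_univ 0) (dotProduct_zero ℓ)
      fun x _ hxℓ => ha x hxℓ)
  · simp only [not_forall] at ha
    obtain ⟨x₁, hx₁ℓ, hx₁a⟩ := ha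
    refine Or.inr (linForm_dvd_of_vanishing hℓ b
      (isOpen_ne_fun (continuous_eval a) continuous_const) hx₁a hx₁ℓ fun x hx hxℓ => ?_)
    obtain ⟨s, hs⟩ := h
    have h' := congrArg (eval x) hs
    rw [map_mul, map_mul, eval_linForm, hxℓ, zero_mul] at h'
    exact (mul_eq_zero.mp h').resolve_left hx

/-- Divisibility between linear forms forces proportionality of the coefficient vectors.
[folklore] -/
theorem exists_eq_smul_of_linForm_dvd {ℓ ℓ' : σ → ℝ} (hℓ : ℓ ≠ 0) (hℓ' : ℓ' ≠ 0)
    (h : (∑ j, C (ℓ' j) * X j : MvPolynomial σ ℝ) ∣ (∑ j, C (ℓ j) * X j : MvPolynomial σ ℝ)) :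
    ∃ c : ℝ, ℓ = c • ℓ' := by
  obtain ⟨s, hs⟩ := h
  have hs0 : s ≠ 0 := by
    rintro rfl
    exact linForm_ne_zero hℓ (by rw [hs, mul_zero])
  have hdeg := congrArg totalDegree hs
  rw [totalDegree_mul_of_isDomain (linForm_ne_zero hℓ') hs0, totalDegree_linForm hℓ,
    totalDegree_linForm hℓ'] at hdeg
  have hs' : s = C (s.coeff 0) := totalDegree_eq_zero_iff_eq_C.mp (by omega)
  refine ⟨s.coeff 0, funext fun i => ?_⟩
  have h' := congrArg (eval (Pi.single i 1)) hs
  rw [hs', map_mul, eval_C, eval_linForm, eval_linForm, dotProduct_single, dotProduct_single,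
    mul_one, mul_one] at h'
  rw [h', Pi.smul_apply, smul_eq_mul, mul_comm]

/-! ### Peeling off linear factors -/

/-- **Peeling.** If `K` pairwise non-proportional nonzero linear forms all divide `q`, then
`q = 0` or `K ≤ totalDegree q`. [folklore] -/
theorem peel (K : ℕ) : ∀ (ℓ : Fin K → σ → ℝ) (q : MvPolynomial σ ℝ), (∀ k, ℓ k ≠ 0) →
    (∀ k k' : Fin K, k ≠ k' → ∀ c : ℝ, ℓ k ≠ c • ℓ k') →
    (∀ k, (∑ j, C (ℓ k j) * X j : MvPolynomial σ ℝ) ∣ q) → q = 0 ∨ K ≤ q.totalDegree := by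
  induction K with
  | zero => exact fun _ _ _ _ _ => Or.inr (Nat.zero_le _)
  | succ K ih =>
    intro ℓ q hne hprop hdvd
    obtain ⟨q', rfl⟩ := hdvd 0
    rcases eq_or_ne q' 0 with rfl | hq'
    · exact Or.inl (mul_zero _)
    have ih' := ih (fun k => ℓ k.succ) q' (fun k => hne k.succ)
      (fun k k' hkk' c => hprop k.succ k'.succ (fun h => hkk' (Fin.succ_injective _ h)) c)
      fun k => ?_
    · rcases ih' with h | h
      · exact absurd h hq'
      · right
        rw [totalDegree_mul_of_isDomain (linForm_ne_zero (hne 0)) hq', totalDegree_linForm (hne 0)]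
        omega
    · rcases linForm_dvd_mul (hne k.succ) (hdvd k.succ) with h | h
      · obtain ⟨c, hc⟩ := exists_eq_smul_of_linForm_dvd (hne 0) (hne k.succ) h
        exact absurd hc (hprop 0 k.succ (Fin.succ_ne_zero k).symm c)
      · exact h

end HyperplaneVanishing

/-- **Facet-contact obstruction, part I (linear factors of hyperplane vanishing).**  If a real
polynomial `q` vanishes on a nonempty relatively open piece `U_k ∩ ker ℓ_k` of each of `K`
pairwise non-proportional hyperplanes `ker ℓ_k` (`ℓ_k ≠ 0`), then every linear form
`∑ j, ℓ_k j X j` divides `q` (`HyperplaneVanishing.linForm_dvd_of_vanishing`), and peeling off these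
pairwise non-associated prime factors gives `q = 0` or `K ≤ totalDegree q`. [folklore] -/
theorem stub_linearFactorsOfHyperplaneVanishing : ∀ (σ : Type) [Fintype σ] [DecidableEq σ] (q : MvPolynomial σ ℝ) (K : ℕ) (ℓ : Fin K → σ → ℝ), (∀ k, ℓ k ≠ 0) → (∀ k k' : Fin K, k ≠ k' → ∀ c : ℝ, ℓ k ≠ c • ℓ k') → (∀ k, ∃ U : Set (σ → ℝ), IsOpen U ∧ (∃ x ∈ U, dotProduct (ℓ k) x = 0) ∧ ∀ x ∈ U, dotProduct (ℓ k) x = 0 → MvPolynomial.eval x q = 0) → q = 0 ∨ K ≤ q.totalDegree := by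
  intro σ _ _ q K ℓ hne hprop hvan
  refine HyperplaneVanishing.peel K ℓ q hne hprop fun k => ?_
  obtain ⟨U, hU, ⟨x₀, hx₀, hx₀ℓ⟩, hq⟩ := hvan k
  exact HyperplaneVanishing.linForm_dvd_of_vanishing (hne k) q hU hx₀ hx₀ℓ hq

end Summit.ValiantsHypothesis.ValiantsHypothesis.Theorems.PermanentalConesPermanentalConeHard
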